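/- Copyright: the b2b-balaban cell (near-miss cell 7), T⁴-continuum fan-out, lineage t4-ne7b-p1 (node U5c COUNT
member).  Released under the licence of the surrounding project. -/
import Summits.QuantumFields.BalabanUV.T4Continuum.Support.HistoryGenealogyExtractionTiming
import Summits.QuantumFields.BalabanUV.T4Continuum.Support.HistoryGenealogyRealiseChain

/-!
# Genealogy REALISATION, part 2 of 2 (H3-(ID), geometric half M3b-1): every genealogy extracted from print's
level-indexed component bookkeeping WITH DOMAINS is a REALISED history of row S1b — from per-level geometric clauses
DISPLAYED on the data (owner module of row NE7b, lineage `t4-ne7b-p1` gen 40, ruling R-OWNER-40-1; re-open object (α)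
of `WALL-NE7b-P1.md` §4 (i)∕(v), `SCOPE-alpha.md` v2 §5 row M3b — PRE-POSITIONING ONLY)

Summits-side support leaf of the T⁴-continuum cell (rung (B)+1 on a FINITE torus only; NOT infinite volume, NOT the
mass gap, NOT the Clay statement; NOT a proof of the spine estimate NE7b, which is the cell's OWN estimate, NOT PRINTED
and NOT PROVED).  [folklore] finite combinatorics in the ℤᵈ index model over row S13's extraction
`HistoryGenealogyExtraction.ComponentHistory.pgen` (p244684; timing `…Timing` p244827) and row S1b's geometric layer
`HistoryRealise.Realises` (p209120), through part 1 `HistoryGenealogyRealiseChain`; nothing printed is asserted, no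
`def … : Prop` fact of Bałaban's, no cite-tagged hypothesis, zero `sorry`.  B16 = [Balaban1989LargeFieldII] pp. 381–387
is a manuscript UNDER AUDIT; the sentences quoted below only LOCATE which printed construction step each displayed clause
transcribes (certified reading C-B16-6, page table `t4/T4-XREAD-NE7b-READING.md` V1–V6∕D1–D7); they are never used as
establishing a disputed step.

WHY.  The class-R field `realised : RealisedDomainsR …` of the headline witness `CountRoadWitnessT3b` (`WALL-NE7b-P1.md`
§2) says «the terms' live structures ARE realised pending pedigrees with domains» (`HistoryRealise.Realises` +
`PendingAt`, `track`, `disjoint`, `inBox`).  Row S13 (M3a) extracted the pedigrees `pgen` from print's component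
bookkeeping typed as abstract DATA (`ComponentHistory γ`: components, new regions, leaf-first constituent lists, the
renewal trigger).  This module adds the GEOMETRY: labels `Lab d = Pt d × Finset (Pt d)` (anchor cube, region — row
S1b's payload convention), per-level CURRENT DOMAINS `dom j c`, and the per-level clauses print's construction is read
to guarantee — DISPLAYED as the hypothesis shape `LevelClauses` with locators, never asserted — and proves that under
them every extracted genealogy is realised by its LAST-EVENT DOMAIN `edom j c`, the current domain being the orbit of
the last-event domain under the flow.  BY-NAME EFFECT ON THE WALL: NONE today (pre-positioning: the instantiation of
the clauses from the level SETS `Z_j` — M3b-2 — and the junction to `RealisedDomainsR` — M4 — are separate modules).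

WHAT IS DEFINED AND PROVED.
§2 The geometric data: `imgC L s dom j` (the image at level `j` of a constituent: one S-operation of the old part's
level-`(j−1)` domain ∕ the new region itself), `noEventPart`, **`edom H dom`** (the LAST-EVENT DOMAIN, by recursion on
the level: inherited through a no-event level, the current domain at an event level; one-step equations), and
**`structure LevelClauses H dom L s R : Prop`** — (G-new) «new large field regions» anchored, face-connected, class
`≥ treeLen` (p. 381∕383); (G-birth) a lone new region IS its component's domain; (G-flow) a component continued ALONE
flows by one S-operation, `dom (j+1) c = Sop (ratio L s j) (dom j p)` («Z = S(Z₀)», (1.83) p. 385, p. 386 l. 1);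
(G-ready) a renewal happens at the FIRST readiness of the continued line («K is the smallest positive integer …»
p. 384; p. 386 ll. 1–3); (G-pend) the old parts of a JOINED component are pending at the join step (not yet
renormalised, p. 386); (G-touch) constituents in leaf-first order, each image touching the union of the later images
(«the corresponding domains intersect, or touch each other», p. 386); (G-join) the joined domain lies inside the union of
the images ((1.84)).
§3 **THE REALISATION THEOREM `realises_pgen`** (under `WF` + `LevelClauses`, by induction on the level through print's
trichotomy): for every `c ∈ comp j`, `Realises L s R (H.pgen j c) (edom H dom j c)` AND
`dom j c = orbit L s (H.pgen j c).lastStep (edom H dom j c) (j − (H.pgen j c).lastStep)` (= `HistoryRealiseCells.curDomain`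
by `rfl`); corollaries `realises_of_mem_comp`, `dom_eq_orbit`, `disjoint_orbit_of_disjoint_dom` (disjoint current
domains of distinct components transfer to the orbits — the `disjoint` field's shape), `adm_of_mem_comp` (row S1b's
derived `Adm`, agreeing with row S13's `adm_pgen`).
HONEST.  Proves nothing of Bałaban's; the clauses are OUR reading of pp. 381–387 as per-level statements about print's
construction (to be instantiated from the level sets in M3b-2, never minted as facts); NE7b NOT proved; spine 0∕9.
HONEST DEPENDENCY (cell): continuum YM on T⁴ ⇐ BetaPertH ∧ nine spine estimates (0/9 proved); BetaPertH ⇐ (D1) ∧ (D4)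
∧ CAP+tail; G-an2-4 gates asym, D1 and NE2/3/4.  This file changes none of it. -/

open Finset
open Literature.MathematicalPhysics.QuantumFieldTheory.Balaban1983to89
open Literature.MathematicalPhysics.QuantumFieldTheory.Balaban1983to89.B13ScaleTransfer
open Literature.MathematicalPhysics.QuantumFieldTheory.Balaban1983to89.TreeLength
open Literature.MathematicalPhysics.QuantumFieldTheory.Balaban1983to89.B16SProfile
open Literature.MathematicalPhysics.QuantumFieldTheory.Balaban1983to89.B16MergeGeometry
open Summit.QuantumFields.BalabanUV.T4Continuum.HistoryAdmissible
open Summit.QuantumFields.BalabanUV.T4Continuum.HistoryAdmissible.PGen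
open Summit.QuantumFields.BalabanUV.T4Continuum.HistoryRealise
open Summit.QuantumFields.BalabanUV.T4Continuum.HistoryGenealogyExtraction

namespace Summit.QuantumFields.BalabanUV.T4Continuum.HistoryGenealogyRealise

noncomputable section

variable {d : ℕ}

/-! ## §2 The geometric data: current domains, last-event domains, and the displayed per-level clauses -/

section Data

variable (L : ℕ) (s : ℕ → ℕ)

/-- **THE IMAGE AT LEVEL `j` OF A CONSTITUENT** of a level-`j` component: an old part `p` (a component of level
`j − 1`) enters through ONE S-operation of its level-`(j−1)` domain («S(Z₀)»); a new region enters as itself.  (At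
level `0` there are no old parts under `WF`; the left branch is then vacuous.) [folklore] -/
def imgC (dom : ℕ → Lab d → Finset (Pt d)) (j : ℕ) : Lab d ⊕ Lab d → Finset (Pt d) :=
  Sum.elim (fun p => Sop (ratio L s (j - 1)) (dom (j - 1) p)) fun n => n.2

/-- image of an old part [folklore] -/
@[simp] theorem imgC_inl (dom : ℕ → Lab d → Finset (Pt d)) (j : ℕ) (p : Lab d) :
    imgC L s dom j (Sum.inl p) = Sop (ratio L s (j - 1)) (dom (j - 1) p) := rfl

/-- image of a new region [folklore] -/
@[simp] theorem imgC_inr (dom : ℕ → Lab d → Finset (Pt d)) (j : ℕ) (n : Lab d) :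
    imgC L s dom j (Sum.inr n) = n.2 := rfl

end Data

/-- the lone old part continued WITHOUT event, if the constituent list and the renewal flag say so [folklore] -/
def noEventPart : List (Lab d ⊕ Lab d) → Bool → Option (Lab d)
  | [Sum.inl p], false => some p
  | _, _ => none

/-- `noEventPart` in the no-event case [folklore] -/
@[simp] theorem noEventPart_inl_false (p : Lab d) : noEventPart [Sum.inl p] false = some p := rfl

/-- `noEventPart` in the renewal case [folklore] -/
@[simp] theorem noEventPart_inl_true (p : Lab d) : noEventPart [Sum.inl p] true = none := rfl

/-- `noEventPart` for a lone new region [folklore] -/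
@[simp] theorem noEventPart_inr (n : Lab d) (b : Bool) : noEventPart [Sum.inr n] b = none := by
  cases b <;> rfl

/-- `noEventPart` for at least two constituents [folklore] -/
@[simp] theorem noEventPart_cons_cons (x y : Lab d ⊕ Lab d) (l : List (Lab d ⊕ Lab d)) (b : Bool) :
    noEventPart (x :: y :: l) b = none := by
  cases x <;> cases b <;> rfl

/-- `noEventPart` for no constituent [folklore] -/
@[simp] theorem noEventPart_nil (b : Bool) : noEventPart ([] : List (Lab d ⊕ Lab d)) b = none := by
  cases b <;> rfl

/-- `noEventPart` returns the lone no-event part only [folklore] -/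
theorem noEventPart_eq_some {l : List (Lab d ⊕ Lab d)} {b : Bool} {p : Lab d} (h : noEventPart l b = some p) :
    l = [Sum.inl p] ∧ b = false := by
  match l, b, h with
  | [Sum.inl q], false, h => simp at h; exact ⟨by rw [h], rfl⟩
  | [Sum.inl q], true, h => simp at h
  | [Sum.inr _], b, h => simp at h
  | [], b, h => simp at h
  | _ :: _ :: _, b, h => simp at h

namespace GeomHistory

variable (H : ComponentHistory (Lab d)) (dom : ℕ → Lab d → Finset (Pt d))

/-- **THE LAST-EVENT DOMAIN** of component `c` of level `j`: through a no-event level it is inherited from the lone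
continued part; at an event level (birth, renewal, join) it is the current domain. [folklore] -/
def edom : ℕ → Lab d → Finset (Pt d)
  | 0, c => dom 0 c
  | j + 1, c =>
      match noEventPart (H.constit (j + 1) c) (H.fieldIn (j + 1) c) with
      | some p => edom j p
      | none => dom (j + 1) c

/-- `edom` at level `0` is the current domain [folklore] -/
@[simp] theorem edom_zero (c : Lab d) : edom H dom 0 c = dom 0 c := rfl

/-- `edom` through a no-event level is inherited [folklore] -/
theorem edom_succ_noEvent {j : ℕ} {c p : Lab d} (hp : H.constit (j + 1) c = [Sum.inl p])
    (hf : H.fieldIn (j + 1) c = false) : edom H dom (j + 1) c = edom H dom j p := by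
  simp [edom, hp, hf]

/-- `edom` at an event level is the current domain [folklore] -/
theorem edom_succ_event {j : ℕ} {c : Lab d} (h : noEventPart (H.constit (j + 1) c) (H.fieldIn (j + 1) c) = none) :
    edom H dom (j + 1) c = dom (j + 1) c := by
  simp [edom, h]

variable (L : ℕ) (s R : ℕ → ℕ)

/-- **THE DISPLAYED PER-LEVEL GEOMETRIC CLAUSES** on the component bookkeeping with domains (OUR reading of B16
pp. 381–387 as statements about print's construction, level by level; hypothesis SHAPE, never asserted; instantiated
from the level sets in M3b-2).  (G-new) every new region `n = (anchor, region)` has its anchor inside, is face-connected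
and has class `≥ treeLen`; (G-birth) a component consisting of a lone new region has that region as its domain;
(G-flow) a component continuing a lone old part flows by ONE S-operation («Z = S(Z₀)»: the no-event step (1.83) and the
renewal alike); (G-ready) a renewal happens exactly at the FIRST readiness of the continued line (its last-event domain
`Stops` at `j − lastStep` and at no earlier index); (G-pend) every old part of a JOINED component is pending at the join
step; (G-touch) the constituents are listed leaf-first: each image touches the union of the later images; (G-join) the
joined domain lies inside the union of the images ((1.84)). [folklore] -/
structure LevelClauses : Prop where
  /-- (G-new) new regions: anchored, face-connected, class at least the tree length -/
  new_ok : ∀ j, ∀ n ∈ H.newReg j, n.1 ∈ n.2 ∧ FaceConnected n.2 ∧ treeLen n.2 ≤ H.cls n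
  /-- (G-birth) a lone new region is its component's domain -/
  dom_birth : ∀ j c n, c ∈ H.comp j → H.constit j c = [Sum.inr n] → dom j c = n.2
  /-- (G-flow) a component continued alone flows by one S-operation -/
  dom_flow : ∀ j c p, c ∈ H.comp (j + 1) → H.constit (j + 1) c = [Sum.inl p] →
    dom (j + 1) c = Sop (ratio L s j) (dom j p)
  /-- (G-ready) renewal at the first readiness of the continued line -/
  ready : ∀ j c p, c ∈ H.comp (j + 1) → H.constit (j + 1) c = [Sum.inl p] → H.fieldIn (j + 1) c = true →
    Stops L s R (H.pgen j p).lastStep (edom H dom j p) (j - (H.pgen j p).lastStep) ∧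
      ∀ k, k < j - (H.pgen j p).lastStep → ¬ Stops L s R (H.pgen j p).lastStep (edom H dom j p) k
  /-- (G-pend) the old parts of a joined component are pending at the join step -/
  pend : ∀ j c, c ∈ H.comp (j + 1) → 2 ≤ (H.constit (j + 1) c).length → ∀ p ∈ H.parts (j + 1) c,
    PendingAt L s R (H.pgen j p).lastStep (edom H dom j p) (j + 1)
  /-- (G-touch) leaf-first order: each image touches the union of the later images -/
  touch : ∀ j c, c ∈ H.comp j → 2 ≤ (H.constit j c).length → ChainTouch ((H.constit j c).map (imgC L s dom j))
  /-- (G-join) the joined domain lies inside the union of the images -/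
  dom_join : ∀ j c, c ∈ H.comp j → 2 ≤ (H.constit j c).length → dom j c ⊆ unionL ((H.constit j c).map (imgC L s dom j))

end GeomHistory

/-! ## §3 The realisation theorem -/

section Main

open GeomHistory ComponentHistory

variable {L : ℕ} {s R : ℕ → ℕ} {H : ComponentHistory (Lab d)} {dom : ℕ → Lab d → Finset (Pt d)}

/-- the pairs (history, last-event domain) of the constituents of a component of level `j + 1` [folklore] -/
def cpairS (H : ComponentHistory (Lab d)) (dom : ℕ → Lab d → Finset (Pt d)) (j : ℕ) :
    Lab d ⊕ Lab d → PGen (Lab d) × Finset (Pt d) :=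
  Sum.elim (fun p => (H.pgen j p, edom H dom j p)) fun n => (PGen.birth (j + 1) (H.cls n) n, n.2)

/-- the pairs (history, domain) of the constituents of a component of level `0` (births only under `WF`) [folklore] -/
def cpair0 (H : ComponentHistory (Lab d)) (dom : ℕ → Lab d → Finset (Pt d)) :
    Lab d ⊕ Lab d → PGen (Lab d) × Finset (Pt d) :=
  Sum.elim (fun p => (H.pgen 0 p, edom H dom 0 p)) fun n => (PGen.birth 0 (H.cls n) n, n.2)

/-- the constituents' histories of a level-`(j+1)` component are the first components of `cpairS` [folklore] -/
theorem constituents_eq_map_cpairS (j : ℕ) (c : Lab d) :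
    H.constituents (H.pgen j) (j + 1) c = ((H.constit (j + 1) c).map (cpairS H dom j)).map Prod.fst := by
  rw [List.map_map]
  unfold ComponentHistory.constituents
  congr 1
  funext x; cases x <;> rfl

/-- a new region, under (G-new), is realised by itself as a birth at any step [folklore] -/
theorem realises_birth_of_new_ok {n : Lab d} (hn : n.1 ∈ n.2 ∧ FaceConnected n.2 ∧ treeLen n.2 ≤ H.cls n) (j : ℕ) :
    Realises L s R (PGen.birth j (H.cls n) n) n.2 :=
  ⟨rfl, hn.1, hn.2.1, hn.2.2⟩

/-- **THE REALISATION THEOREM.**  Under `WF` and the displayed per-level clauses, EVERY extracted genealogy is realised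
by its last-event domain, and the current domain is the orbit of the last-event domain from the last step:
`Realises L s R (H.pgen j c) (edom H dom j c) ∧ dom j c = orbit L s (H.pgen j c).lastStep (edom H dom j c) (j − lastStep)`
for every `c ∈ comp j` (induction on the level through print's trichotomy: no event — inherited; renewal — (G-flow) +
(G-ready); lone birth — (G-new) + (G-birth); join chain — `realises_assemble_of_two_le` with (G-pend), (G-touch),
(G-join), births pending trivially at their own step). [folklore] -/
theorem realises_pgen (hW : H.WF) (hG : LevelClauses H dom L s R) :
    ∀ (j : ℕ) (c : Lab d), c ∈ H.comp j →
      Realises L s R (H.pgen j c) (edom H dom j c) ∧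
        dom j c = orbit L s (H.pgen j c).lastStep (edom H dom j c) (j - (H.pgen j c).lastStep)
  | 0, c, hc => by
      -- level 0: births only
      have hl0 : lefts (H.constit 0 c) = [] := hW.parts_zero c
      have hne : H.constit 0 c ≠ [] := hW.nonempty 0 c hc
      -- every constituent is a new region of step 0
      have hmem : ∀ x ∈ H.constit 0 c, ∃ n, x = Sum.inr n ∧ n ∈ H.newReg 0 := by
        intro x hx
        obtain ⟨n, rfl⟩ := exists_inr_of_lefts_eq_nil hl0 x hx
        exact ⟨n, rfl, hW.news_sub 0 c hc n ((mem_rights_iff n _).2 hx)⟩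
      have hbirths : H.births 0 c = ((H.constit 0 c).map (cpair0 H dom)).map Prod.fst := by
        rw [List.map_map]
        unfold ComponentHistory.births ComponentHistory.news
        rw [show Prod.fst ∘ cpair0 H dom = Sum.elim (fun p => H.pgen 0 p) fun n => PGen.birth 0 (H.cls n) n from
          funext fun x => by cases x <;> rfl, map_sum_elim_of_lefts_eq_nil _ _ _ hl0]
      match hcs : H.constit 0 c, hne, hmem with
      | [], hne, _ => exact (hne rfl).elim
      | [x], _, hmem =>
          obtain ⟨n, rfl, hn⟩ := hmem x (by simp)
          have hpg : H.pgen 0 c = PGen.birth 0 (H.cls n) n := H.pgen_zero_birth c n hcs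
          have hd : dom 0 c = n.2 := hG.dom_birth 0 c n hc hcs
          rw [hpg, edom_zero, hd]
          exact ⟨realises_birth_of_new_ok (hG.new_ok 0 n hn) 0, by simp [lastStep]⟩
      | x :: y :: l, _, hmem =>
          have h2 : 2 ≤ (H.constit 0 c).length := by rw [hcs]; simp
          -- images of births at their own step are the regions
          have himg : ((H.constit 0 c).map (cpair0 H dom)).map (img L s 0) = (H.constit 0 c).map (imgC L s dom 0) := by
            rw [List.map_map]
            refine List.map_congr_left fun z hz => ?_
            obtain ⟨n, rfl, -⟩ := hmem z (hcs ▸ hz)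
            simp [cpair0, img, lastStep]
          have hall : ∀ UZ ∈ (H.constit 0 c).map (cpair0 H dom),
              Realises L s R UZ.1 UZ.2 ∧ UZ.1.lastStep ≤ 0 ∧ PendingAt L s R UZ.1.lastStep UZ.2 0 := by
            intro UZ hUZ
            obtain ⟨z, hz, rfl⟩ := List.mem_map.1 hUZ
            obtain ⟨n, rfl, hn⟩ := hmem z (hcs ▸ hz)
            exact ⟨realises_birth_of_new_ok (hG.new_ok 0 n hn) 0, le_rfl, pendingAt_self L s R 0 _⟩
          have hct : ChainTouch (((H.constit 0 c).map (cpair0 H dom)).map (img L s 0)) := by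
            rw [himg]; exact hG.touch 0 c hc h2
          have hZ : dom 0 c ⊆ unionL (((H.constit 0 c).map (cpair0 H dom)).map (img L s 0)) := by
            rw [himg]; exact hG.dom_join 0 c hc h2
          have hlen : 2 ≤ ((H.constit 0 c).map (cpair0 H dom)).length := by simpa using h2
          obtain ⟨hR, hlast⟩ := realises_assemble_of_two_le (L := L) (s := s) (R := R) c 0 0 false _ hlen hall hct hZ
          rw [pgen_zero_eq_assemble, hbirths, edom_zero]
          exact ⟨hR, by rw [hlast]; simp⟩
  | j + 1, c, hc => by
      have hne : H.constit (j + 1) c ≠ [] := hW.nonempty (j + 1) c hc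
      -- the induction hypothesis for the old parts, and their images
      have ih : ∀ p ∈ H.parts (j + 1) c,
          Realises L s R (H.pgen j p) (edom H dom j p) ∧
            dom j p = orbit L s (H.pgen j p).lastStep (edom H dom j p) (j - (H.pgen j p).lastStep) :=
        fun p hp => realises_pgen hW hG j p (hW.parts_sub j c hc p hp)
      have himgp : ∀ p ∈ H.parts (j + 1) c,
          img L s (j + 1) (H.pgen j p, edom H dom j p) = Sop (ratio L s j) (dom j p) := by
        intro p hp
        have ht : (H.pgen j p).lastStep ≤ j := H.lastStep_pgen_le j p
        rw [(ih p hp).2, img, orbit_level_succ L s ht]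
      match hcs : H.constit (j + 1) c, hne with
      | [], hne => exact (hne rfl).elim
      | [Sum.inl p], _ =>
          have hp : p ∈ H.parts (j + 1) c := by simp [ComponentHistory.parts, hcs]
          have ht : (H.pgen j p).lastStep ≤ j := H.lastStep_pgen_le j p
          have hflow := hG.dom_flow j c p hc hcs
          cases hf : H.fieldIn (j + 1) c with
          | false =>
              -- NO EVENT: inherited
              rw [H.pgen_succ_noEvent j c p hcs hf, edom_succ_noEvent H dom hcs hf]
              refine ⟨(ih p hp).1, ?_⟩
              rw [hflow, (ih p hp).2, ← orbit_level_succ L s ht]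
          | true =>
              -- RENEWAL at the first readiness
              obtain ⟨hstop, hfirst⟩ := hG.ready j c p hc hcs hf
              have hev : edom H dom (j + 1) c = dom (j + 1) c :=
                edom_succ_event H dom (by rw [hcs, hf]; rfl)
              rw [H.pgen_succ_renew j c p hcs hf, hev]
              refine ⟨⟨edom H dom j p, (ih p hp).1, hstop, hfirst, ?_⟩, by simp [lastStep]⟩
              rw [hflow, (ih p hp).2, ← orbit_level_succ L s ht]
      | [Sum.inr n], _ =>
          -- LONE BIRTH
          have hn : n ∈ H.newReg (j + 1) := hW.news_sub (j + 1) c hc n (by simp [ComponentHistory.news, hcs])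
          have hev : edom H dom (j + 1) c = dom (j + 1) c := edom_succ_event H dom (by rw [hcs]; simp)
          rw [H.pgen_succ_birth j c n hcs, hev, hG.dom_birth (j + 1) c n hc hcs]
          exact ⟨realises_birth_of_new_ok (hG.new_ok (j + 1) n hn) (j + 1), by simp [lastStep]⟩
      | x :: y :: l, _ =>
          -- JOIN CHAIN at step j + 1
          have h2 : 2 ≤ (H.constit (j + 1) c).length := by rw [hcs]; simp
          have hev : edom H dom (j + 1) c = dom (j + 1) c := edom_succ_event H dom (by rw [hcs]; simp)
          have himg : ((H.constit (j + 1) c).map (cpairS H dom j)).map (img L s (j + 1)) =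
              (H.constit (j + 1) c).map (imgC L s dom (j + 1)) := by
            rw [List.map_map]
            refine List.map_congr_left fun z hz => ?_
            cases z with
            | inl p =>
                have hp : p ∈ H.parts (j + 1) c := (mem_lefts_iff p _).2 hz
                simpa [cpairS] using himgp p hp
            | inr n => simp [cpairS, img, lastStep]
          have hall : ∀ UZ ∈ (H.constit (j + 1) c).map (cpairS H dom j),
              Realises L s R UZ.1 UZ.2 ∧ UZ.1.lastStep ≤ j + 1 ∧ PendingAt L s R UZ.1.lastStep UZ.2 (j + 1) := by
            intro UZ hUZ
            obtain ⟨z, hz, rfl⟩ := List.mem_map.1 hUZ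
            cases z with
            | inl p =>
                have hp : p ∈ H.parts (j + 1) c := (mem_lefts_iff p _).2 hz
                exact ⟨(ih p hp).1, (H.lastStep_pgen_le j p).trans (Nat.le_succ j), hG.pend j c hc h2 p hp⟩
            | inr n =>
                have hn : n ∈ H.newReg (j + 1) := hW.news_sub (j + 1) c hc n ((mem_rights_iff n _).2 hz)
                exact ⟨realises_birth_of_new_ok (hG.new_ok (j + 1) n hn) (j + 1), le_rfl,
                  pendingAt_self L s R (j + 1) _⟩
          have hct : ChainTouch (((H.constit (j + 1) c).map (cpairS H dom j)).map (img L s (j + 1))) := by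
            rw [himg]; exact hG.touch (j + 1) c hc h2
          have hZ : dom (j + 1) c ⊆ unionL (((H.constit (j + 1) c).map (cpairS H dom j)).map (img L s (j + 1))) := by
            rw [himg]; exact hG.dom_join (j + 1) c hc h2
          have hlen : 2 ≤ ((H.constit (j + 1) c).map (cpairS H dom j)).length := by simpa using h2
          obtain ⟨hR, hlast⟩ := realises_assemble_of_two_le (L := L) (s := s) (R := R) c (j + 1) j
            (H.ren (j + 1) c) _ hlen hall hct hZ
          rw [pgen_succ_eq_assemble, constituents_eq_map_cpairS, hev]
          exact ⟨hR, by rw [hlast]; simp⟩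

/-- **EVERY COMPONENT'S GENEALOGY IS REALISED by its last-event domain.** [folklore] -/
theorem realises_of_mem_comp (hW : H.WF) (hG : LevelClauses H dom L s R) {j : ℕ} {c : Lab d} (hc : c ∈ H.comp j) :
    Realises L s R (H.pgen j c) (edom H dom j c) :=
  (realises_pgen hW hG j c hc).1

/-- **THE CURRENT DOMAIN IS THE ORBIT OF THE LAST-EVENT DOMAIN** (`HistoryRealiseCells.curDomain` by `rfl`). [folklore] -/
theorem dom_eq_orbit (hW : H.WF) (hG : LevelClauses H dom L s R) {j : ℕ} {c : Lab d} (hc : c ∈ H.comp j) :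
    dom j c = orbit L s (H.pgen j c).lastStep (edom H dom j c) (j - (H.pgen j c).lastStep) :=
  (realises_pgen hW hG j c hc).2

/-- **DISJOINT CURRENT DOMAINS TRANSFER TO THE ORBITS** (the shape of the `disjoint` field of `RealisedDomains`:
distinct live components of one term have disjoint current domains at the cutoff). [folklore] -/
theorem disjoint_orbit_of_disjoint_dom (hW : H.WF) (hG : LevelClauses H dom L s R) {K : ℕ} {c c' : Lab d}
    (hc : c ∈ H.comp K) (hc' : c' ∈ H.comp K) (hdis : Disjoint (dom K c) (dom K c')) :
    Disjoint (orbit L s (H.pgen K c).lastStep (edom H dom K c) (K - (H.pgen K c).lastStep))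
      (orbit L s (H.pgen K c').lastStep (edom H dom K c') (K - (H.pgen K c').lastStep)) := by
  rwa [← dom_eq_orbit hW hG hc, ← dom_eq_orbit hW hG hc']

/-- the realised genealogy of a component obeys print's timing discipline at its level (row S1b's `adm_of_realises`,
agreeing with row S13's `adm_pgen`) [folklore] -/
theorem adm_of_mem_comp (hW : H.WF) (hG : LevelClauses H dom L s R) {j : ℕ} {c : Lab d} (hc : c ∈ H.comp j) :
    (H.pgen j c).Adm j :=
  adm_of_realises _ _ (realises_of_mem_comp hW hG hc) (H.lastStep_pgen_le j c)

end Main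

end

end Summit.QuantumFields.BalabanUV.T4Continuum.HistoryGenealogyRealise
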